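import Summits.Parity.GeneralizedHardyLittlewood.Theorems.PrimeLevelFamEdgeMomentsBeyondDiagonalDiagBoseSymm
import Mathlib.MeasureTheory.Integral.IntegralEqImproper
import HarnessLib

/-!
# Route `PrimeLevelFamEdge`, crux K_A `MomentsBeyondDiagonal` (stmt-Parity-20007), line «petersson_layers» v4, stub `stub_diag`:
# **census R2 — the SHELL IDENTITY for the two-dimensional Bose coefficients (reduction of `c_ab` to ONE variable)**

For the Bose coefficients `c_ab(y) = ∫_{u₁>0}(log u₁)^a∫_{u₂>y/u₁}B(u₁+u₂)(log u₂)^b` (`B(φ) = e^{−φ}(1−e^{−φ})^{−2}`,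
`…DiagBoseOuter.bose_expand`, p812352) the product coordinate `η = u₁u₂` turns the difference of two coefficients into a
one-variable integral of the **shell profile**
`I_ab(η) = ∫_{u>0}(log u)^a(log(η/u))^b B(u+η/u) du/u`:

* `bose_coeff_sub_eq_integral_shell` — **`c_ab(y₁) − c_ab(y₂) = ∫_{y₁<η≤y₂} I_ab(η) dη`** for `0 < y₁ ≤ y₂`.

So `c_ab` is an antiderivative of `−I_ab`: the full small-`y` structure of `c_ab` (polynomial in `log(1/y)` plus a
small remainder of bounded variation, as the corner/Abel step of the `stub_diag` assembly requires — cf. K_B's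
`CornerWeightE`: `𝒲 = ½log(1/y) + E`, `0 ≤ E ≤ √y`, `E` monotone) reduces to the ONE-VARIABLE asymptotics of `η·I_ab(η)`
(substitution `u = √η·v`, weight `v/(1+v²)²`; next file).

Def-free; theorems only. Helper `--supports stmt-Parity-20007`; closes nothing; K_A, K_B and the Parity summit are NOT
proved; nothing about Landau–Siegel zeros.

## References
* E. Kowalski, P. Michel, J. VanderKam, J. reine angew. Math. 526 (2000), (22)–(28) pp. 12–15.
  [cite: KowalskiMichelVanderKam2000, (22)–(28) — derivation (residues of the diagonal weight, real-variable form)]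
-/

noncomputable section

open Real Set MeasureTheory Filter Function Finset

namespace Summit.Parity.GeneralizedHardyLittlewood.Theorems.MomentsBeyondDiagonal.DiagLines

/-- `e^{−y/u}/u ≤ 1/y` for `u, y > 0` (`e^{y/u} ≥ 1 + y/u`). [folklore] -/
theorem exp_neg_div_div_le {u y : ℝ} (hu : 0 < u) (hy : 0 < y) : Real.exp (-(y / u)) / u ≤ y⁻¹ := by
  have h1 : y / u ≤ Real.exp (y / u) := by
    have := Real.add_one_le_exp (y / u); linarith
  have hyu : 0 < y / u := div_pos hy hu
  have h2 : Real.exp (-(y / u)) ≤ (y / u)⁻¹ := by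
    rw [Real.exp_neg]; exact inv_anti₀ hyu h1
  calc Real.exp (-(y / u)) / u ≤ (y / u)⁻¹ / u := div_le_div_of_nonneg_right h2 hu.le
    _ = y⁻¹ := by field_simp

/-- Measurability of the shell integrand in the coordinates `(u, η)`. [folklore] -/
theorem measurable_shellGuard (y₁ y₂ : ℝ) (a b : ℕ) :
    Measurable (uncurry fun u η : ℝ ↦ if 0 < u ∧ 0 < η ∧ y₁ < η ∧ η ≤ y₂ then
        Real.log u ^ a * Real.log (η / u) ^ b *
          (Real.exp (-(u + η / u)) / (1 - Real.exp (-(u + η / u))) ^ 2) / u else 0) := by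
  have hφ : Measurable fun p : ℝ × ℝ ↦ p.1 + p.2 / p.1 := measurable_fst.add (measurable_snd.div measurable_fst)
  have h1 : Measurable fun p : ℝ × ℝ ↦ Real.log p.1 ^ a * Real.log (p.2 / p.1) ^ b *
      (Real.exp (-(p.1 + p.2 / p.1)) / (1 - Real.exp (-(p.1 + p.2 / p.1))) ^ 2) / p.1 :=
    ((((Real.measurable_log.comp measurable_fst).pow_const a).mul
      ((Real.measurable_log.comp (measurable_snd.div measurable_fst)).pow_const b)).mul
      ((Real.measurable_exp.comp hφ.neg).div ((measurable_const.sub (Real.measurable_exp.comp hφ.neg)).pow_const 2))).div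
      measurable_fst
  refine Measurable.ite ?_ h1 measurable_const
  exact (measurableSet_lt measurable_const measurable_fst).inter
    ((measurableSet_lt measurable_const measurable_snd).inter
      ((measurableSet_lt measurable_const measurable_snd).inter (measurableSet_le measurable_snd measurable_const)))

/-- `(1+|log u|)^n e^{−u}` is integrable on `(0,∞)`. [folklore] -/
theorem integrableOn_exp_neg_mul_one_add_abs_log_pow (n : ℕ) :
    IntegrableOn (fun u : ℝ ↦ Real.exp (-u) * (1 + |Real.log u|) ^ n) (Ioi 0) := by
  have h : IntegrableOn (fun u : ℝ ↦ ∑ k ∈ Finset.range (n + 1),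
      (n.choose k : ℝ) * (Real.exp (-u) * |(0 : ℝ) + Real.log u| ^ k)) (Ioi 0) :=
    integrable_finsetSum _ fun k _ ↦ (integrableOn_exp_neg_mul_abs_logPow 0 k).const_mul _
  refine h.congr_fun (fun u _ ↦ ?_) measurableSet_Ioi
  rw [add_comm (1 : ℝ), add_pow, Finset.mul_sum]
  refine Finset.sum_congr rfl fun k _ ↦ ?_
  rw [zero_add, one_pow, mul_one]
  ring

/-- **Integrability of the shell integrand on `(0,∞)²`** (`0 < y₁ ≤ y₂`). [folklore] -/
theorem integrable_shellGuard {y₁ y₂ : ℝ} (hy₁ : 0 < y₁) (a b : ℕ) :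
    Integrable (uncurry fun u η : ℝ ↦ if 0 < u ∧ 0 < η ∧ y₁ < η ∧ η ≤ y₂ then
        Real.log u ^ a * Real.log (η / u) ^ b *
          (Real.exp (-(u + η / u)) / (1 - Real.exp (-(u + η / u))) ^ 2) / u else 0)
      ((volume.restrict (Ioi (0 : ℝ))).prod (volume.restrict (Ioi (0 : ℝ)))) := by
  set Cy : ℝ := ((1 - Real.exp (-Real.sqrt y₁)) ^ 2)⁻¹ with hCy
  have hCy0 : 0 ≤ Cy := by rw [hCy]; positivity
  -- dominating product
  have hA : Integrable (fun u : ℝ ↦ Cy * y₁⁻¹ * (Real.exp (-u) * (1 + |Real.log u|) ^ (a + b)))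
      (volume.restrict (Ioi (0 : ℝ))) := (integrableOn_exp_neg_mul_one_add_abs_log_pow (a + b)).const_mul _
  have hBf : IntegrableOn (fun η : ℝ ↦ (1 + |Real.log η|) ^ b) (Ioc y₁ y₂) := by
    refine (ContinuousOn.integrableOn_Icc ?_).mono_set Ioc_subset_Icc_self
    refine (continuousOn_const.add (continuousOn_log.mono fun η hη ↦ ?_).abs).pow b
    exact ne_of_gt (hy₁.trans_le hη.1)
  have hB : Integrable (fun η : ℝ ↦ (Ioc y₁ y₂).indicator (fun η : ℝ ↦ (1 + |Real.log η|) ^ b) η)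
      (volume.restrict (Ioi (0 : ℝ))) :=
    ((integrable_indicator_iff measurableSet_Ioc).2 hBf).integrableOn
  have hmaj := hA.mul_prod hB
  refine Integrable.mono' hmaj (measurable_shellGuard y₁ y₂ a b).aestronglyMeasurable (ae_of_all _ fun p ↦ ?_)
  simp only [uncurry]
  by_cases hc : 0 < p.1 ∧ 0 < p.2 ∧ y₁ < p.2 ∧ p.2 ≤ y₂
  · rw [if_pos hc]
    obtain ⟨hu, hη, h1, h2⟩ := hc
    rw [indicator_of_mem (Set.mem_Ioc.2 ⟨h1, h2⟩)]
    have hu₂ : y₁ / p.1 < p.2 / p.1 := div_lt_div_of_pos_right h1 hu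
    have hK := bose_kernel_le hy₁ hu hu₂
    have hK0 : 0 ≤ Real.exp (-(p.1 + p.2 / p.1)) / (1 - Real.exp (-(p.1 + p.2 / p.1))) ^ 2 := by positivity
    have hexp : Real.exp (-(p.2 / p.1)) / p.1 ≤ y₁⁻¹ := by
      have h := exp_neg_div_div_le hu hy₁
      have hmono : Real.exp (-(p.2 / p.1)) ≤ Real.exp (-(y₁ / p.1)) := Real.exp_le_exp.2 (by linarith [hu₂.le])
      exact (div_le_div_of_nonneg_right hmono hu.le).trans h
    have hlog : |Real.log (p.2 / p.1)| ≤ (1 + |Real.log p.1|) * (1 + |Real.log p.2|) := by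
      rw [Real.log_div hη.ne' hu.ne']
      calc |Real.log p.2 - Real.log p.1| ≤ |Real.log p.2| + |Real.log p.1| := abs_sub _ _
        _ ≤ (1 + |Real.log p.1|) * (1 + |Real.log p.2|) := by
            nlinarith [abs_nonneg (Real.log p.1), abs_nonneg (Real.log p.2)]
    rw [norm_div, norm_mul, norm_mul, norm_pow, norm_pow, Real.norm_eq_abs, Real.norm_eq_abs,
      Real.norm_of_nonneg hK0, Real.norm_of_nonneg hu.le]
    calc |Real.log p.1| ^ a * |Real.log (p.2 / p.1)| ^ b *
          (Real.exp (-(p.1 + p.2 / p.1)) / (1 - Real.exp (-(p.1 + p.2 / p.1))) ^ 2) / p.1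
        ≤ (1 + |Real.log p.1|) ^ a * ((1 + |Real.log p.1|) * (1 + |Real.log p.2|)) ^ b *
            (Cy * (Real.exp (-p.1) * Real.exp (-(p.2 / p.1)))) / p.1 := by
          gcongr
          exact le_add_of_nonneg_left zero_le_one
      _ = Cy * (Real.exp (-p.1) * (1 + |Real.log p.1|) ^ (a + b)) * (Real.exp (-(p.2 / p.1)) / p.1) *
            (1 + |Real.log p.2|) ^ b := by rw [mul_pow, pow_add]; ring
      _ ≤ Cy * (Real.exp (-p.1) * (1 + |Real.log p.1|) ^ (a + b)) * y₁⁻¹ * (1 + |Real.log p.2|) ^ b := by gcongr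
      _ = Cy * y₁⁻¹ * (Real.exp (-p.1) * (1 + |Real.log p.1|) ^ (a + b)) * (1 + |Real.log p.2|) ^ b := by ring
  · rw [if_neg hc, norm_zero]
    exact mul_nonneg (mul_nonneg (mul_nonneg hCy0 (by positivity)) (by positivity)) (indicator_nonneg (fun η _ ↦ by positivity) _)

/-- **Inner substitution `η = u·u₂`.** For `u > 0`:
`∫_{u₂>0} 1[y₁ < u u₂ ≤ y₂](log u)^a(log u₂)^b B(u+u₂) du₂ = ∫_{η>0} 1[y₁<η≤y₂](log u)^a(log(η/u))^b B(u+η/u)/u dη`. [folklore] -/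
theorem shell_inner_subst {y₁ y₂ u : ℝ} (hu : 0 < u) (a b : ℕ) :
    ∫ u₂ in Ioi (0 : ℝ), (if 0 < u ∧ 0 < u₂ ∧ y₁ < u * u₂ ∧ u * u₂ ≤ y₂ then
        Real.exp (-(u + u₂)) / (1 - Real.exp (-(u + u₂))) ^ 2 * Real.log u ^ a * Real.log u₂ ^ b else 0) =
      ∫ η in Ioi (0 : ℝ), (if 0 < u ∧ 0 < η ∧ y₁ < η ∧ η ≤ y₂ then
        Real.log u ^ a * Real.log (η / u) ^ b *
          (Real.exp (-(u + η / u)) / (1 - Real.exp (-(u + η / u))) ^ 2) / u else 0) := by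
  set g : ℝ → ℝ := fun η ↦ if 0 < u ∧ 0 < η ∧ y₁ < η ∧ η ≤ y₂ then
      Real.log u ^ a * Real.log (η / u) ^ b *
        (Real.exp (-(u + η / u)) / (1 - Real.exp (-(u + η / u))) ^ 2) / u else 0 with hg
  have hsub := MeasureTheory.integral_comp_mul_left_Ioi g 0 hu
  rw [mul_zero, smul_eq_mul] at hsub
  have hRHS : ∫ η in Ioi (0 : ℝ), g η = ∫ u₂ in Ioi (0 : ℝ), u * g (u * u₂) := by
    rw [integral_const_mul, hsub, ← mul_assoc, mul_inv_cancel₀ hu.ne', one_mul]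
  rw [hRHS]
  refine setIntegral_congr_fun measurableSet_Ioi fun u₂ hu₂ ↦ ?_
  have hu₂ : 0 < u₂ := hu₂
  simp only [hg]
  have huu : 0 < u * u₂ := mul_pos hu hu₂
  have hdiv : u * u₂ / u = u₂ := by field_simp
  by_cases hc : y₁ < u * u₂ ∧ u * u₂ ≤ y₂
  · rw [if_pos ⟨hu, hu₂, hc⟩, if_pos ⟨hu, huu, hc⟩, hdiv]
    field_simp
  · rw [if_neg (fun h ↦ hc h.2.2), if_neg (fun h ↦ hc h.2.2), mul_zero]

/-- **THE SHELL IDENTITY.** For `0 < y₁ ≤ y₂` and all `a, b`: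
`c_ab(y₁) − c_ab(y₂) = ∫_{y₁<η≤y₂} ∫_{u>0} (log u)^a (log(η/u))^b B(u+η/u) du/u dη`
(`B(φ) = e^{−φ}(1−e^{−φ})^{−2}`; product coordinate `η = u₁u₂` and Fubini).
[cite: KowalskiMichelVanderKam2000, (22)–(28) — derivation (real-variable model of the residues of the diagonal weight)] -/
theorem bose_coeff_sub_eq_integral_shell {y₁ y₂ : ℝ} (hy₁ : 0 < y₁) (h12 : y₁ ≤ y₂) (a b : ℕ) :
    (∫ u₁ in Ioi (0 : ℝ), Real.log u₁ ^ a *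
        ∫ u₂ in Ioi (y₁ / u₁), Real.exp (-(u₁ + u₂)) / (1 - Real.exp (-(u₁ + u₂))) ^ 2 * Real.log u₂ ^ b) -
      (∫ u₁ in Ioi (0 : ℝ), Real.log u₁ ^ a *
        ∫ u₂ in Ioi (y₂ / u₁), Real.exp (-(u₁ + u₂)) / (1 - Real.exp (-(u₁ + u₂))) ^ 2 * Real.log u₂ ^ b) =
      ∫ η in Ioc y₁ y₂, ∫ u in Ioi (0 : ℝ), Real.log u ^ a * Real.log (η / u) ^ b *
        (Real.exp (-(u + η / u)) / (1 - Real.exp (-(u + η / u))) ^ 2) / u := by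
  have hy₂ : 0 < y₂ := hy₁.trans_le h12
  set μ₂ : Measure (ℝ × ℝ) := (volume.restrict (Ioi (0 : ℝ))).prod (volume.restrict (Ioi (0 : ℝ))) with hμ₂
  set G₁ : ℝ × ℝ → ℝ := fun p ↦ if 0 < p.1 ∧ 0 < p.2 ∧ y₁ < p.1 * p.2 then
      Real.exp (-(p.1 + p.2)) / (1 - Real.exp (-(p.1 + p.2))) ^ 2 * Real.log p.1 ^ a * Real.log p.2 ^ b else 0 with hG₁
  set G₂ : ℝ × ℝ → ℝ := fun p ↦ if 0 < p.1 ∧ 0 < p.2 ∧ y₂ < p.1 * p.2 then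
      Real.exp (-(p.1 + p.2)) / (1 - Real.exp (-(p.1 + p.2))) ^ 2 * Real.log p.1 ^ a * Real.log p.2 ^ b else 0 with hG₂
  set S : ℝ × ℝ → ℝ := fun p ↦ if 0 < p.1 ∧ 0 < p.2 ∧ y₁ < p.1 * p.2 ∧ p.1 * p.2 ≤ y₂ then
      Real.exp (-(p.1 + p.2)) / (1 - Real.exp (-(p.1 + p.2))) ^ 2 * Real.log p.1 ^ a * Real.log p.2 ^ b else 0 with hS
  have hG₁_int : Integrable G₁ μ₂ := integrable_boseGuard hy₁ a b
  have hG₂_int : Integrable G₂ μ₂ := integrable_boseGuard hy₂ a b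
  have hsplit : ∀ p, G₁ p - G₂ p = S p := by
    intro p
    simp only [hG₁, hG₂, hS]
    by_cases h0 : 0 < p.1 ∧ 0 < p.2 ∧ y₁ < p.1 * p.2
    · rw [if_pos h0]
      by_cases h2 : y₂ < p.1 * p.2
      · rw [if_pos ⟨h0.1, h0.2.1, h2⟩, if_neg (fun h ↦ absurd h.2.2.2 (not_le.2 h2)), sub_self]
      · rw [if_neg (fun h ↦ h2 h.2.2), if_pos ⟨h0.1, h0.2.1, h0.2.2, not_lt.1 h2⟩, sub_zero]
    · have h2 : ¬ (0 < p.1 ∧ 0 < p.2 ∧ y₂ < p.1 * p.2) := fun h ↦ h0 ⟨h.1, h.2.1, lt_of_le_of_lt h12 h.2.2⟩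
      rw [if_neg h0, if_neg h2, if_neg (fun h ↦ h0 ⟨h.1, h.2.1, h.2.2.1⟩), sub_zero]
  have hS_int : Integrable S μ₂ := (hG₁_int.sub hG₂_int).congr (ae_of_all _ fun p ↦ hsplit p)
  -- the two coefficients as integrals over the product measure
  have hc : ∀ {y : ℝ}, 0 < y → ∫ u₁ in Ioi (0 : ℝ), Real.log u₁ ^ a *
        ∫ u₂ in Ioi (y / u₁), Real.exp (-(u₁ + u₂)) / (1 - Real.exp (-(u₁ + u₂))) ^ 2 * Real.log u₂ ^ b =
      ∫ p, (fun p : ℝ × ℝ ↦ if 0 < p.1 ∧ 0 < p.2 ∧ y < p.1 * p.2 then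
        Real.exp (-(p.1 + p.2)) / (1 - Real.exp (-(p.1 + p.2))) ^ 2 * Real.log p.1 ^ a * Real.log p.2 ^ b else 0) p ∂μ₂ := by
    intro y hy
    rw [integral_prod _ (integrable_boseGuard hy a b)]
    refine setIntegral_congr_fun measurableSet_Ioi fun u₁ hu₁ ↦ ?_
    exact (integral_boseGuard_snd hy hu₁ a b).symm
  rw [hc hy₁, hc hy₂, ← integral_sub hG₁_int hG₂_int, integral_congr_ae (ae_of_all _ fun p ↦ hsplit p),
    integral_prod S hS_int]
  -- Step A: inner substitution
  have hA : ∫ u₁ in Ioi (0 : ℝ), ∫ u₂ in Ioi (0 : ℝ), S (u₁, u₂) =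
      ∫ u₁ in Ioi (0 : ℝ), ∫ η in Ioi (0 : ℝ), (if 0 < u₁ ∧ 0 < η ∧ y₁ < η ∧ η ≤ y₂ then
        Real.log u₁ ^ a * Real.log (η / u₁) ^ b *
          (Real.exp (-(u₁ + η / u₁)) / (1 - Real.exp (-(u₁ + η / u₁))) ^ 2) / u₁ else 0) := by
    refine setIntegral_congr_fun measurableSet_Ioi fun u₁ hu₁ ↦ ?_
    simp only [hS]
    exact shell_inner_subst hu₁ a b
  -- Step B: Fubini in `(u, η)`
  have hB := integral_integral_swap (integrable_shellGuard (y₂ := y₂) hy₁ a b)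
  -- Step C: the inner `u`-integral for fixed `η`
  have hC : ∫ η in Ioi (0 : ℝ), ∫ u₁ in Ioi (0 : ℝ), (if 0 < u₁ ∧ 0 < η ∧ y₁ < η ∧ η ≤ y₂ then
        Real.log u₁ ^ a * Real.log (η / u₁) ^ b *
          (Real.exp (-(u₁ + η / u₁)) / (1 - Real.exp (-(u₁ + η / u₁))) ^ 2) / u₁ else 0) =
      ∫ η in Ioi (0 : ℝ), (Ioc y₁ y₂).indicator (fun η ↦ ∫ u in Ioi (0 : ℝ), Real.log u ^ a * Real.log (η / u) ^ b *
        (Real.exp (-(u + η / u)) / (1 - Real.exp (-(u + η / u))) ^ 2) / u) η := by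
    refine setIntegral_congr_fun measurableSet_Ioi fun η hη ↦ ?_
    have hη : 0 < η := hη
    by_cases hc : y₁ < η ∧ η ≤ y₂
    · rw [indicator_of_mem (Set.mem_Ioc.2 hc)]
      refine setIntegral_congr_fun measurableSet_Ioi fun u hu ↦ ?_
      rw [if_pos ⟨hu, hη, hc⟩]
    · rw [indicator_of_notMem (fun h ↦ hc (Set.mem_Ioc.1 h))]
      refine (setIntegral_congr_fun measurableSet_Ioi fun u hu ↦ ?_).trans (integral_zero _ _)
      rw [if_neg (fun h ↦ hc h.2.2)]
  have hsub : Ioc y₁ y₂ ⊆ Ioi 0 := fun η hη ↦ hy₁.trans hη.1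
  rw [hA, hB, hC, setIntegral_indicator measurableSet_Ioc, inter_eq_right.2 hsub]

end Summit.Parity.GeneralizedHardyLittlewood.Theorems.MomentsBeyondDiagonal.DiagLines

end
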